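import Summits.QuantumFields.YangMills.Theorems.BalabanUVNodesN15KingModelTreeGraphEngine

/-!
# BalabanUVNodes ∕ N15 — THE KING-MODEL RUNG (PART Ι-b): THE POWER COUNTING OF PROPOSITION 3.6 FOR **TREE GRAPHS** — a generic engine, RATE HALF:
# the TWO-LATTICE η-rate of a tree-shaped graph from LINE-SUM RATES `Σ_{y′} η′^d|G′_ℓ(x′, y′) − G_ℓ(x, y)| ≤ ρ_ℓ` — «the same graph with ONE factor replaced by
# its rate», CLOSED under the vertex sums by leaf-stripping and the re-pairing `x′ ∈ B^n(x)`
# (Track A, DAG node N15 = NE2; FAN-OUT v1.1 §N15 s3 «KING-MODEL RUNG … NE2's analogue DECIDED in the model»)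

HONEST FRAMING.  Count-neutral (cell `pub-ymgap`, seat `pub-ymgap-dag-n15-e` g26; `--supports stmt-QuantumFields-27366 --as helper` = K3⁸
`SpineGivenEndpointR13SepCoPHV`).  TEMPLATE LITERATURE: C. King, *The U(1) Higgs model. I. The continuum limit*, Commun. Math. Phys. **102** (1986) 649–677
[King1986], Proposition 3.6 (3.56) p. 662, proof pp. 664–665.  Part Ι-a (`…KingModelTreeGraphEngine`) has the tree shapes `STree`, their values `treeVal`∕
`treeAmp` and the size half (leaf-stripping power counting); this file adds the two-lattice comparison.  MODEL-LEVEL GENERIC ENGINE (abstract kernels on finite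
site sorts over `RCLike 𝕜`, a pairing `pt : S′ → S` with uniform fibres `#pt⁻¹(x) = m`, weights `m·w′ = w` — part Η-a's currency `L^{nd}η′^d = η^d`).  NOT
Bałaban's non-abelian `G(U)` of [B9]; NOT a node discharge; nothing continuum ∕ ℝ⁴ ∕ OS ∕ mass-gap ∕ Clay.  0 `sorry`; standard axioms.

THE PRINT.  p. 665 [PDF 17]: *«If we replace such a propagator in E^{(k+n)}(H), the error is the same graph with a difference of propagators on one line. Using
the method presented, this error is bounded … This replacement is made for every internal line … Having done this, we can replace the sums of internal
vertices x′ over T_{η′} by sums over x ∈ T_η, and this gives exactly E^{(k)}(H), proving Proposition 3.6»*; p. 664 [PDF 16]: *«When x′ ∈ T_{η′}, we denote by x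
that point in T_η for which x′ ∈ B^n(x).»*; p. 665: *«The sources g_{μν}(x′), h(x′) and the partition of unity function χ(x′) can be replaced by g_{μν}(x), h(x)
and χ(x) respectively, since their derivatives are uniformly bounded.»*

WHAT THIS FILE PROVES (namespace `Summit.QuantumFields.YangMills.BalabanUVNodes.N15KingModelRung.Graph`).
* §1 `sum_comp_eq_card_mul_sum` (ONE-VERTEX RE-PAIRING `Σ_{y′} F(pt y′) = m·Σ_y F(y)` — part Η-a's `sum_comp_eq_pow_mul_sum` for a single vertex), `sum_repaired`,
  `lineSum_repaired` (a coarse kernel read through the pairing has the coarse line sum, `m·‖w′‖ = ‖w‖` by part Η-a's `norm_weight_repair`).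
* §2 `treeRate ρ c ϑ q T` (recursively: `treeRate (line ℓ t r) = ρ_ℓ·B_t·B_r + c_ℓ·(R_t·B_r + B_t·R_r)`), `treeRate_nonneg`; ★ **`treeRate_ratio`**: for rates
  proportional to sizes (`ρ_ℓ = r_ℓc_ℓ`, `ϑ_υ = s_υq_υ`) the recursion CLOSES: `treeRate = (Σ_ℓ r_ℓ + Σ_υ s_υ)·treeBound` — the η-rate of a tree is (the sum
  over its factors of the relative rate of ONE factor) × its size (part Η-a's `…_of_ratio` law, closed under the vertex sums).
* §3 ★★★ **`norm_treeVal_sub_le`** — THE TWO-LATTICE η-RATE OF A TREE: line sums `≤ c_ℓ` on both lattices (the fine one in coarse currency — Prop. 3.7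
  «Furthermore …»), LINE-SUM RATES `Σ_{y′} ‖w′‖·‖P′_ℓ(x′, y′) − P_ℓ(pt x′, pt y′)‖ ≤ ρ_ℓ` (Prop. 3.9 (3.73) summed by (3.68); for the full propagator summed
  over the slices with the `S^c` member — part Ι-c), one-vertex sizes `q_υ` and rates `‖u′_υ(x′) − u_υ(pt x′)‖ ≤ ϑ_υ` give
  `‖treeVal′ T x′ − treeVal T (pt x′)‖ ≤ treeRate ρ c ϑ q T` (induction: at each line `a′b′ − ab = (a′ − a)b′ + a(b′ − b)` with the coarse vertex sum re-paired
  onto the fine lattice); ★★ **`norm_treeAmp_sub_le`** (`‖treeAmp′ − treeAmp‖ ≤ Γ′·B_T + Γ·R_T`, `Γ′ ≥ Σ_{x′}‖w′‖‖g′(x′) − g(pt x′)‖` the root source's rate);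
  ★★ **`norm_treeAmp_sub_le_ratio`** (`≤ (Γ′ + Γ·(Σ_ℓ r_ℓ + Σ_υ s_υ))·treeBound` — with part Ι-c's `r_ℓ = C₂·L^{−γK}` on every line of King's `A = 0` model this
  is (3.56)'s `L^{−γk}` for tree graphs, part Ι-d).

HONEST SCOPE.  As part Ι-a: TREE-shaped graphs only (no orderings∕loop degrees∕§3.5); abstract kernels and one-vertex factors; (3.56)'s tree decay between
external points not displayed.  Locators: [King1986] Prop. 3.6 (3.56) p.662, pp.664–665 (replacement, pairing, re-pairing, sources).
-/

noncomputable section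

namespace Summit.QuantumFields.YangMills.BalabanUVNodes.N15KingModelRung.Graph

open scoped BigOperators
open Finset
open STree

variable {𝕜 : Type*} [RCLike 𝕜]
variable {ι υ : Type*} {S S' : Type*} [Fintype S] [Fintype S']

section Rate

variable [DecidableEq S]

/-! ## §1 Re-pairing one vertex sum -/

/-- **ONE-VERTEX RE-PAIRING**: if every fibre of `pt` has `m` points then `Σ_{y′ ∈ S′} F(pt y′) = m·Σ_{y ∈ S} F(y)` (part Η-a's `sum_comp_eq_pow_mul_sum` for a
single vertex). [cite: King1986, p.665 («we can replace the sums of internal vertices x′ over T_{η′} by sums over x ∈ T_η»)] -/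
theorem sum_comp_eq_card_mul_sum {R : Type*} [AddCommMonoid R] (pt : S' → S) {m : ℕ}
    (hfib : ∀ x : S, (univ.filter fun x' : S' => pt x' = x).card = m) (F : S → R) :
    ∑ y' : S', F (pt y') = m • ∑ y : S, F y := by
  classical
  rw [← sum_fiberwise_of_maps_to (s := (univ : Finset S')) (t := (univ : Finset S)) (g := pt) (fun _ _ => mem_univ _), smul_sum]
  refine sum_congr rfl fun y _ => ?_
  rw [sum_congr rfl fun y' hy' => by rw [(mem_filter.1 hy').2], sum_const, hfib y]

/-- **a coarse kernel read through the pairing has the coarse line sum**: `Σ_{y′} ‖w′‖·F(pt y′) = Σ_y ‖w‖·F(y)` for `m·w′ = w`. [cite: King1986, p.665] -/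
theorem lineSum_repaired (pt : S' → S) {m : ℕ} (hfib : ∀ x : S, (univ.filter fun x' : S' => pt x' = x).card = m) {w w' : 𝕜}
    (hw : (m : 𝕜) * w' = w) (F : S → ℝ) : ∑ y' : S', ‖w'‖ * F (pt y') = ∑ y : S, ‖w‖ * F y := by
  rw [sum_comp_eq_card_mul_sum pt hfib (fun y => ‖w'‖ * F y), nsmul_eq_mul, mul_sum]
  refine sum_congr rfl fun y _ => ?_
  rw [← mul_assoc, norm_weight_repair hw]

/-- the same in `𝕜`: `Σ_{y′} w′·F(pt y′) = Σ_y w·F(y)`. [cite: King1986, p.665] -/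
theorem sum_repaired (pt : S' → S) {m : ℕ} (hfib : ∀ x : S, (univ.filter fun x' : S' => pt x' = x).card = m) {w w' : 𝕜}
    (hw : (m : 𝕜) * w' = w) (F : S → 𝕜) : ∑ y' : S', w' * F (pt y') = ∑ y : S, w * F y := by
  rw [sum_comp_eq_card_mul_sum pt hfib (fun y => w' * F y), nsmul_eq_mul, mul_sum]
  refine sum_congr rfl fun y _ => ?_
  rw [← mul_assoc, hw]

/-! ## §2 The rate bookkeeping -/

/-- **THE η-RATE BOOKKEEPING OF A TREE** (recursively): a bare vertex has the rate `ϑ_υ` of its factor; hanging `t` on `r` by `ℓ`,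
`R(line ℓ t r) = ρ_ℓ·B_t·B_r + c_ℓ·(R_t·B_r + B_t·R_r)` — the line's own rate times the sizes of the rest, plus the line's size times the rates of the two
pieces («the same graph with ONE factor replaced by its rate», summed over the factors). [cite: King1986, p.665 (proof of Prop. 3.6)] -/
def treeRate (ρ c : ι → ℝ) (ϑ q : υ → ℝ) : STree ι υ → ℝ
  | vtx υ₀ => ϑ υ₀
  | line ℓ t r => ρ ℓ * treeBound c q t * treeBound c q r
      + c ℓ * (treeRate ρ c ϑ q t * treeBound c q r + treeBound c q t * treeRate ρ c ϑ q r)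

/-- reading. [folklore] -/
@[simp] theorem treeRate_vtx (ρ c : ι → ℝ) (ϑ q : υ → ℝ) (υ₀ : υ) : treeRate ρ c ϑ q (vtx υ₀ : STree ι υ) = ϑ υ₀ := rfl

/-- reading. [folklore] -/
@[simp] theorem treeRate_line (ρ c : ι → ℝ) (ϑ q : υ → ℝ) (ℓ : ι) (t r : STree ι υ) :
    treeRate ρ c ϑ q (line ℓ t r) = ρ ℓ * treeBound c q t * treeBound c q r
      + c ℓ * (treeRate ρ c ϑ q t * treeBound c q r + treeBound c q t * treeRate ρ c ϑ q r) := rfl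

/-- the rate is nonnegative for nonnegative data. [folklore] -/
theorem treeRate_nonneg {ρ c : ι → ℝ} {ϑ q : υ → ℝ} (hρ : ∀ ℓ, 0 ≤ ρ ℓ) (hc : ∀ ℓ, 0 ≤ c ℓ) (hϑ : ∀ υ₀, 0 ≤ ϑ υ₀) (hq : ∀ υ₀, 0 ≤ q υ₀) :
    ∀ T : STree ι υ, 0 ≤ treeRate ρ c ϑ q T
  | vtx υ₀ => hϑ υ₀
  | line ℓ t r => by
      have := treeBound_nonneg hc hq t
      have := treeBound_nonneg hc hq r
      have := treeRate_nonneg hρ hc hϑ hq t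
      have := treeRate_nonneg hρ hc hϑ hq r
      have := hρ ℓ
      have := hc ℓ
      rw [treeRate_line]
      positivity

/-- ★ **THE RECURSION CLOSES FOR PROPORTIONAL RATES**: if every line's rate is `r_ℓ` times its size and every one-vertex rate is `s_υ` times its size, then
`treeRate = (Σ_ℓ r_ℓ + Σ_υ s_υ)·treeBound` — the η-rate of the tree is the sum over its factors of the relative rate of ONE factor, times its size (part Η-a's
`norm_graphVal_sub_graphVal_le_of_ratio`, now closed under the vertex sums). [cite: King1986, p.665 («This replacement is made for every internal line»)] -/
theorem treeRate_ratio (r c : ι → ℝ) (s q : υ → ℝ) :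
    ∀ T : STree ι υ, treeRate (fun ℓ => r ℓ * c ℓ) c (fun υ₀ => s υ₀ * q υ₀) q T = (lsum r T + vsum s T) * treeBound c q T
  | vtx υ₀ => by simp [lsum, vsum]
  | line ℓ t r' => by
      rw [treeRate_line, treeRate_ratio r c s q t, treeRate_ratio r c s q r', treeBound_line]
      simp only [lsum, vsum]
      ring

/-! ## §3 The two-lattice η-rate of a tree -/

/-- ★★★ **THE TWO-LATTICE η-RATE OF A TREE GRAPH.**  Coarse data (`S`, weight `w`, kernels `P_ℓ`, one-vertex factors `u_υ`) and fine data (`S′`, `w′`, `P′_ℓ`,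
`u′_υ`) over a pairing `pt : S′ → S` with uniform fibres (`#pt⁻¹(x) = m`, `m·w′ = w` — King's `x′ ∈ B^n(x)`, `L^{nd}η′^d = η^d`).  HYPOTHESES, all uniform in
the base point: line sums `Σ_y ‖w‖‖P_ℓ(x, y)‖ ≤ c_ℓ` and `Σ_{y′} ‖w′‖‖P′_ℓ(x′, y′)‖ ≤ c_ℓ` (the fine sizes in coarse currency — Prop. 3.7 «Furthermore …»);
LINE-SUM RATES `Σ_{y′} ‖w′‖‖P′_ℓ(x′, y′) − P_ℓ(pt x′, pt y′)‖ ≤ ρ_ℓ` (Prop. 3.9 (3.73) summed by (3.68), and for the full propagator summed over the slices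
with the `S^c` member — part Ι-b); one-vertex sizes `q_υ` on both lattices and rates `‖u′_υ(x′) − u_υ(pt x′)‖ ≤ ϑ_υ`.  CONCLUSION: for every tree `T` and every
fine placement `x′` of the root, `‖treeVal′ T x′ − treeVal T (pt x′)‖ ≤ treeRate ρ c ϑ q T`.  Proof by leaf-stripping: at each line
`a′b′ − ab = (a′ − a)b′ + a(b′ − b)`, the coarse vertex sum re-paired onto the fine lattice («we can replace the sums of internal vertices x′ over T_{η′} by
sums over x ∈ T_η»), and «the error is the same graph with a difference of propagators on one line».
[cite: King1986, pp.664–665 (proof of Prop. 3.6), Prop. 3.6 (3.56) p.662] -/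
theorem norm_treeVal_sub_le (pt : S' → S) {m : ℕ} (hfib : ∀ x : S, (univ.filter fun x' : S' => pt x' = x).card = m)
    {w w' : 𝕜} (hw : (m : 𝕜) * w' = w) (P : ι → S → S → 𝕜) (P' : ι → S' → S' → 𝕜) (u : υ → S → 𝕜) (u' : υ → S' → 𝕜)
    (c ρ : ι → ℝ) (q ϑ : υ → ℝ)
    (hP : ∀ ℓ x, ∑ y, ‖w‖ * ‖P ℓ x y‖ ≤ c ℓ) (hP' : ∀ ℓ x', ∑ y', ‖w'‖ * ‖P' ℓ x' y'‖ ≤ c ℓ)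
    (hρ : ∀ ℓ x', ∑ y', ‖w'‖ * ‖P' ℓ x' y' - P ℓ (pt x') (pt y')‖ ≤ ρ ℓ)
    (hu : ∀ υ₀ x, ‖u υ₀ x‖ ≤ q υ₀) (hu' : ∀ υ₀ x', ‖u' υ₀ x'‖ ≤ q υ₀) (hϑ : ∀ υ₀ x', ‖u' υ₀ x' - u υ₀ (pt x')‖ ≤ ϑ υ₀) :
    ∀ (T : STree ι υ) (x' : S'), ‖treeVal w' P' u' T x' - treeVal w P u T (pt x')‖ ≤ treeRate ρ c ϑ q T
  | vtx υ₀, x' => by simpa only [treeVal_vtx, treeRate_vtx] using hϑ υ₀ x'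
  | line ℓ t r, x' => by
      -- nonnegativity of the data (from the hypotheses at the point in hand)
      have hq0 : ∀ υ₀, 0 ≤ q υ₀ := fun υ₀ => (norm_nonneg _).trans (hu' υ₀ x')
      have hc0 : ∀ ℓ', 0 ≤ c ℓ' := fun ℓ' => (sum_nonneg fun y _ => mul_nonneg (norm_nonneg _) (norm_nonneg _)).trans (hP' ℓ' x')
      have hρ0 : ∀ ℓ', 0 ≤ ρ ℓ' := fun ℓ' => (sum_nonneg fun y _ => mul_nonneg (norm_nonneg _) (norm_nonneg _)).trans (hρ ℓ' x')
      have hϑ0 : ∀ υ₀, 0 ≤ ϑ υ₀ := fun υ₀ => (norm_nonneg _).trans (hϑ υ₀ x')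
      have hBt := treeBound_nonneg hc0 hq0 t
      have hBr := treeBound_nonneg hc0 hq0 r
      have hRt := treeRate_nonneg hρ0 hc0 hϑ0 hq0 t
      -- the four inductive inputs
      have ht' : ∀ y', ‖treeVal w' P' u' t y'‖ ≤ treeBound c q t := fun y' => norm_treeVal_le w' P' u' c q hP' hu' t y'
      have hr' : ‖treeVal w' P' u' r x'‖ ≤ treeBound c q r := norm_treeVal_le w' P' u' c q hP' hu' r x'
      have ht : ∀ y, ‖treeVal w P u t y‖ ≤ treeBound c q t := fun y => norm_treeVal_le w P u c q hP hu t y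
      have hdt : ∀ y', ‖treeVal w' P' u' t y' - treeVal w P u t (pt y')‖ ≤ treeRate ρ c ϑ q t :=
        fun y' => norm_treeVal_sub_le pt hfib hw P P' u u' c ρ q ϑ hP hP' hρ hu hu' hϑ t y'
      have hdr : ‖treeVal w' P' u' r x' - treeVal w P u r (pt x')‖ ≤ treeRate ρ c ϑ q r :=
        norm_treeVal_sub_le pt hfib hw P P' u u' c ρ q ϑ hP hP' hρ hu hu' hϑ r x'
      -- names
      set a' : 𝕜 := ∑ y', w' * P' ℓ x' y' * treeVal w' P' u' t y' with ha'
      set b' : 𝕜 := treeVal w' P' u' r x' with hb'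
      set a : 𝕜 := ∑ y, w * P ℓ (pt x') y * treeVal w P u t y with ha
      set b : 𝕜 := treeVal w P u r (pt x') with hb
      rw [treeVal_line, treeVal_line, treeRate_line]
      show ‖a' * b' - a * b‖ ≤ _
      -- the coarse vertex sum re-paired onto the fine lattice
      have ha_re : a = ∑ y', w' * (P ℓ (pt x') (pt y') * treeVal w P u t (pt y')) := by
        rw [ha, sum_repaired pt hfib hw (fun y => P ℓ (pt x') y * treeVal w P u t y)]
        exact sum_congr rfl fun y _ => by ring
      -- `‖a‖ ≤ c_ℓ B_t`
      have ha_le : ‖a‖ ≤ c ℓ * treeBound c q t := by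
        calc ‖a‖ ≤ ∑ y, ‖w * P ℓ (pt x') y * treeVal w P u t y‖ := norm_sum_le _ _
          _ ≤ ∑ y, ‖w‖ * ‖P ℓ (pt x') y‖ * treeBound c q t := sum_le_sum fun y _ => by
              rw [norm_mul, norm_mul]
              exact mul_le_mul_of_nonneg_left (ht y) (mul_nonneg (norm_nonneg _) (norm_nonneg _))
          _ = (∑ y, ‖w‖ * ‖P ℓ (pt x') y‖) * treeBound c q t := by rw [sum_mul]
          _ ≤ c ℓ * treeBound c q t := mul_le_mul_of_nonneg_right (hP ℓ (pt x')) hBt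
      -- the fine line sum of the COARSE kernel read through the pairing
      have hPre : ∑ y', ‖w'‖ * ‖P ℓ (pt x') (pt y')‖ ≤ c ℓ := by
        rw [lineSum_repaired pt hfib hw (fun y => ‖P ℓ (pt x') y‖)]
        exact hP ℓ (pt x')
      -- `‖a′ − a‖ ≤ ρ_ℓ B_t + c_ℓ R_t`
      have hda : ‖a' - a‖ ≤ ρ ℓ * treeBound c q t + c ℓ * treeRate ρ c ϑ q t := by
        have hsplit : a' - a = ∑ y', (w' * (P' ℓ x' y' - P ℓ (pt x') (pt y')) * treeVal w' P' u' t y'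
            + w' * P ℓ (pt x') (pt y') * (treeVal w' P' u' t y' - treeVal w P u t (pt y'))) := by
          rw [ha', ha_re, ← sum_sub_distrib]
          exact sum_congr rfl fun y' _ => by ring
        rw [hsplit]
        calc ‖∑ y', (w' * (P' ℓ x' y' - P ℓ (pt x') (pt y')) * treeVal w' P' u' t y'
              + w' * P ℓ (pt x') (pt y') * (treeVal w' P' u' t y' - treeVal w P u t (pt y')))‖
            ≤ ∑ y', (‖w'‖ * ‖P' ℓ x' y' - P ℓ (pt x') (pt y')‖ * treeBound c q t
              + ‖w'‖ * ‖P ℓ (pt x') (pt y')‖ * treeRate ρ c ϑ q t) := by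
              refine (norm_sum_le _ _).trans (sum_le_sum fun y' _ => (norm_add_le _ _).trans (add_le_add ?_ ?_))
              · rw [norm_mul, norm_mul]
                exact mul_le_mul_of_nonneg_left (ht' y') (mul_nonneg (norm_nonneg _) (norm_nonneg _))
              · rw [norm_mul, norm_mul]
                exact mul_le_mul_of_nonneg_left (hdt y') (mul_nonneg (norm_nonneg _) (norm_nonneg _))
          _ = (∑ y', ‖w'‖ * ‖P' ℓ x' y' - P ℓ (pt x') (pt y')‖) * treeBound c q t
              + (∑ y', ‖w'‖ * ‖P ℓ (pt x') (pt y')‖) * treeRate ρ c ϑ q t := by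
              rw [sum_add_distrib, sum_mul, sum_mul]
          _ ≤ ρ ℓ * treeBound c q t + c ℓ * treeRate ρ c ϑ q t :=
              add_le_add (mul_le_mul_of_nonneg_right (hρ ℓ x') hBt) (mul_le_mul_of_nonneg_right hPre hRt)
      -- assemble `a′b′ − ab = (a′ − a)b′ + a(b′ − b)`
      have hid : a' * b' - a * b = (a' - a) * b' + a * (b' - b) := by ring
      rw [hid]
      calc ‖(a' - a) * b' + a * (b' - b)‖ ≤ ‖a' - a‖ * ‖b'‖ + ‖a‖ * ‖b' - b‖ := by
            refine (norm_add_le _ _).trans ?_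
            rw [norm_mul, norm_mul]
        _ ≤ (ρ ℓ * treeBound c q t + c ℓ * treeRate ρ c ϑ q t) * treeBound c q r + (c ℓ * treeBound c q t) * treeRate ρ c ϑ q r :=
            add_le_add (mul_le_mul hda hr' (norm_nonneg _) (add_nonneg (mul_nonneg (hρ0 ℓ) hBt) (mul_nonneg (hc0 ℓ) hRt)))
              (mul_le_mul ha_le hdr (norm_nonneg _) (mul_nonneg (hc0 ℓ) hBt))
        _ = ρ ℓ * treeBound c q t * treeBound c q r
            + c ℓ * (treeRate ρ c ϑ q t * treeBound c q r + treeBound c q t * treeRate ρ c ϑ q r) := by ring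

/-- ★★ **THE η-RATE OF THE AMPLITUDE**: with root sources `g` (coarse, `Σ_x ‖w‖‖g(x)‖ ≤ Γ`) and `g′` (fine, `Σ_{x′} ‖w′‖‖g′(x′) − g(pt x′)‖ ≤ Γ′` — King p. 665
*«The sources g_{μν}(x′), h(x′) … can be replaced by g_{μν}(x), h(x) … since their derivatives are uniformly bounded»*):
`‖treeAmp′ T − treeAmp T‖ ≤ Γ′·treeBound T + Γ·treeRate T`. [cite: King1986, pp.664–665 (proof of Prop. 3.6), Prop. 3.6 (3.56) p.662] -/
theorem norm_treeAmp_sub_le (pt : S' → S) {m : ℕ} (hfib : ∀ x : S, (univ.filter fun x' : S' => pt x' = x).card = m)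
    {w w' : 𝕜} (hw : (m : 𝕜) * w' = w) (P : ι → S → S → 𝕜) (P' : ι → S' → S' → 𝕜) (u : υ → S → 𝕜) (u' : υ → S' → 𝕜)
    (g : S → 𝕜) (g' : S' → 𝕜) (c ρ : ι → ℝ) (q ϑ : υ → ℝ) {Γ Γ' : ℝ}
    (hP : ∀ ℓ x, ∑ y, ‖w‖ * ‖P ℓ x y‖ ≤ c ℓ) (hP' : ∀ ℓ x', ∑ y', ‖w'‖ * ‖P' ℓ x' y'‖ ≤ c ℓ)
    (hρ : ∀ ℓ x', ∑ y', ‖w'‖ * ‖P' ℓ x' y' - P ℓ (pt x') (pt y')‖ ≤ ρ ℓ)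
    (hu : ∀ υ₀ x, ‖u υ₀ x‖ ≤ q υ₀) (hu' : ∀ υ₀ x', ‖u' υ₀ x'‖ ≤ q υ₀) (hϑ : ∀ υ₀ x', ‖u' υ₀ x' - u υ₀ (pt x')‖ ≤ ϑ υ₀)
    (hg : ∑ x, ‖w‖ * ‖g x‖ ≤ Γ) (hg' : ∑ x', ‖w'‖ * ‖g' x' - g (pt x')‖ ≤ Γ')
    (T : STree ι υ) (hB : 0 ≤ treeBound c q T) (hR : 0 ≤ treeRate ρ c ϑ q T) :
    ‖treeAmp w' P' u' g' T - treeAmp w P u g T‖ ≤ Γ' * treeBound c q T + Γ * treeRate ρ c ϑ q T := by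
  have hB' : ∀ x', ‖treeVal w' P' u' T x'‖ ≤ treeBound c q T := fun x' => norm_treeVal_le w' P' u' c q hP' hu' T x'
  have hD : ∀ x', ‖treeVal w' P' u' T x' - treeVal w P u T (pt x')‖ ≤ treeRate ρ c ϑ q T :=
    fun x' => norm_treeVal_sub_le pt hfib hw P P' u u' c ρ q ϑ hP hP' hρ hu hu' hϑ T x'
  have hre : treeAmp w P u g T = ∑ x', w' * (g (pt x') * treeVal w P u T (pt x')) := by
    unfold treeAmp
    rw [sum_repaired pt hfib hw (fun x => g x * treeVal w P u T x)]
    exact sum_congr rfl fun x _ => by ring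
  have hgre : ∑ x', ‖w'‖ * ‖g (pt x')‖ ≤ Γ := by
    rw [lineSum_repaired pt hfib hw (fun x => ‖g x‖)]; exact hg
  have hsplit : treeAmp w' P' u' g' T - treeAmp w P u g T
      = ∑ x', (w' * (g' x' - g (pt x')) * treeVal w' P' u' T x' + w' * g (pt x') * (treeVal w' P' u' T x' - treeVal w P u T (pt x'))) := by
    rw [hre]
    unfold treeAmp
    rw [← sum_sub_distrib]
    exact sum_congr rfl fun x' _ => by ring
  rw [hsplit]
  calc ‖∑ x', (w' * (g' x' - g (pt x')) * treeVal w' P' u' T x' + w' * g (pt x') * (treeVal w' P' u' T x' - treeVal w P u T (pt x')))‖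
      ≤ ∑ x', (‖w'‖ * ‖g' x' - g (pt x')‖ * treeBound c q T + ‖w'‖ * ‖g (pt x')‖ * treeRate ρ c ϑ q T) := by
        refine (norm_sum_le _ _).trans (sum_le_sum fun x' _ => (norm_add_le _ _).trans (add_le_add ?_ ?_))
        · rw [norm_mul, norm_mul]
          exact mul_le_mul_of_nonneg_left (hB' x') (mul_nonneg (norm_nonneg _) (norm_nonneg _))
        · rw [norm_mul, norm_mul]
          exact mul_le_mul_of_nonneg_left (hD x') (mul_nonneg (norm_nonneg _) (norm_nonneg _))
    _ = (∑ x', ‖w'‖ * ‖g' x' - g (pt x')‖) * treeBound c q T + (∑ x', ‖w'‖ * ‖g (pt x')‖) * treeRate ρ c ϑ q T := by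
        rw [sum_add_distrib, sum_mul, sum_mul]
    _ ≤ Γ' * treeBound c q T + Γ * treeRate ρ c ϑ q T :=
        add_le_add (mul_le_mul_of_nonneg_right hg' hB) (mul_le_mul_of_nonneg_right hgre hR)

/-- ★★ **THE PROPORTIONAL FORM**: if every line's rate is `r_ℓ·c_ℓ` and every one-vertex rate is `s_υ·q_υ`, then
`‖treeAmp′ T − treeAmp T‖ ≤ (Γ′ + Γ·(Σ_ℓ r_ℓ + Σ_υ s_υ))·treeBound c q T` — for King's full `A = 0` propagators part Ι-b gives `r_ℓ = C₂·L^{−γK}` on every line,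
whence (3.56)'s `L^{−γk}` for tree graphs (part Ι-c). [cite: King1986, Prop. 3.6 (3.56) p.662, pp.664–665] -/
theorem norm_treeAmp_sub_le_ratio (pt : S' → S) {m : ℕ} (hfib : ∀ x : S, (univ.filter fun x' : S' => pt x' = x).card = m)
    {w w' : 𝕜} (hw : (m : 𝕜) * w' = w) (P : ι → S → S → 𝕜) (P' : ι → S' → S' → 𝕜) (u : υ → S → 𝕜) (u' : υ → S' → 𝕜)
    (g : S → 𝕜) (g' : S' → 𝕜) (c r : ι → ℝ) (q s : υ → ℝ) {Γ Γ' : ℝ}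
    (hc : ∀ ℓ, 0 ≤ c ℓ) (hr : ∀ ℓ, 0 ≤ r ℓ) (hq : ∀ υ₀, 0 ≤ q υ₀) (hs : ∀ υ₀, 0 ≤ s υ₀)
    (hP : ∀ ℓ x, ∑ y, ‖w‖ * ‖P ℓ x y‖ ≤ c ℓ) (hP' : ∀ ℓ x', ∑ y', ‖w'‖ * ‖P' ℓ x' y'‖ ≤ c ℓ)
    (hρ : ∀ ℓ x', ∑ y', ‖w'‖ * ‖P' ℓ x' y' - P ℓ (pt x') (pt y')‖ ≤ r ℓ * c ℓ)
    (hu : ∀ υ₀ x, ‖u υ₀ x‖ ≤ q υ₀) (hu' : ∀ υ₀ x', ‖u' υ₀ x'‖ ≤ q υ₀) (hϑ : ∀ υ₀ x', ‖u' υ₀ x' - u υ₀ (pt x')‖ ≤ s υ₀ * q υ₀)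
    (hg : ∑ x, ‖w‖ * ‖g x‖ ≤ Γ) (hg' : ∑ x', ‖w'‖ * ‖g' x' - g (pt x')‖ ≤ Γ') (T : STree ι υ) :
    ‖treeAmp w' P' u' g' T - treeAmp w P u g T‖ ≤ (Γ' + Γ * (lsum r T + vsum s T)) * treeBound c q T := by
  have hB := treeBound_nonneg hc hq T
  have hR := treeRate_nonneg (fun ℓ => mul_nonneg (hr ℓ) (hc ℓ)) hc (fun υ₀ => mul_nonneg (hs υ₀) (hq υ₀)) hq T
  have h := norm_treeAmp_sub_le pt hfib hw P P' u u' g g' c (fun ℓ => r ℓ * c ℓ) q (fun υ₀ => s υ₀ * q υ₀) hP hP' hρ hu hu' hϑ hg hg' T hB hR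
  rw [treeRate_ratio r c s q T] at h
  linarith [h]

end Rate

end Summit.QuantumFields.YangMills.BalabanUVNodes.N15KingModelRung.Graph

end
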